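import Mathlib
import HarnessLib
import Summits.CriticalPhenomena.CardyFormulaZ2.Theses.CardyComplexCone
import Summits.CriticalPhenomena.CardyFormulaZ2.Theorems.CardyComplexConeDefs
import Literature.Probability.LatticeModels.DartPhase

/-!
# Line `z4-trace-character-collapse` for the crux `CardyComplexCone.CoherentMorera`
(item stmt-CriticalPhenomena-11388, route `CardyComplexCone`, rank 4) — CHECKED SKELETON (crux-plan, round 1)

Crux (rev 3, edge-guarded): `CoherentMorera : EdgeCoherence → EdgePrecompact →
(WeakHolomorphyFamilies ∧ VertexPrecompactFamilies)` for the spin-`1/3` VERTEX observable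
`F_δ(z) = ∫ passageSum (medialExploration (Λ δ) ω) δ (1/3) z` of critical bond percolation on `δℤ²`
along every discretisation family `Λ` of every Dobrushin (Jordan) domain `D`.

Idea (card `Cruxes/CoherentMorera/Ideas/z4-trace-character-collapse.md`, triage r1: 3 × pass; lever
"L2" of the panel): the EXACT quarter-turn covariance of the whole lattice problem,
`E^{iD,iΛ}_δ(Rv, Rf − e₀) = E^{D,Λ}_δ(v, f)` (`R(x₀,x₁) = (−x₁,x₀)`; corner classes `o = f − v` cycle
`0 → −e₀ → −e₀−e₁ → −e₁ → 0` = `classShift`), together with the UNIVERSALITY of the class vector `u`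
posited by `EdgeCoherence` (one `u` for all Dobrushin domains and all families) makes `u ∘ classShift`
a second coherence vector for the SAME corner observable (`stub_coherenceShift`); a `2 × 2`
elimination then gives, at the lattice level and without limit objects, the dichotomy
"`u` is a `ℤ₄`-character (`u ∘ classShift = λ·u` on the four classes) OR every corner value is
`o(δ^{1/3})` uniformly on compacts for every `(D, Λ)`" (`stub_characterOrDegenerate`); and the
TRACE COLLAPSE (`stub_traceCollapse`): a non-trivial character has `Σ_o u(o) = 0` (proved below,
`sum_classes_eq_zero_of_character`), so coherence forces the spin-`1/3` SITE mode
`A₀(v) = Σ_{4 classes} E_δ(v,·)` to be `O(ε)δ^{1/3}` uniformly (also in the degenerate branch), while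
the trivial character (`u` constant on the cycle, `const_of_character_one`) forces the STAGGERED mode
`A₂ = E₀ − E₁ + E₂ − E₃` to be `O(ε)δ^{1/3}` uniformly; counting `O(δ⁻²)` sites in `tsupport φ` turns
either bound into the vanishing of the corresponding `δ^{5/3}`-normalised pairing. The two remaining
inputs are the panel's lever "L1" (`stub_pairingIdentity_of`: the `χ = +i` vertex relation of
Duminil-Copin 2012 Prop. 4 for the tree's corner observable, `stub_vertexRelation`, summed by parts
against the test function gives `∂̄`-pairing of `A₀` `= i·∂`-pairing of `A₂` `+ O(δ^{2/3})`, so the two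
mode pairings vanish together) and the corner→vertex TRACE IDENTITY
`2cos(π/12)·F_δ(z) = Σ_{c∼z} E_δ(c)` (proved pathwise by cdisprove g2; it drives both
`stub_vertexToModeZero` — clause (i) of the conclusion ⟺ mode-0 pairing null — and
`stub_precompactTransfer` — clause (ii) from `EdgePrecompact` alone, Disproof §F honoured).

Composition (pure logic, sorry-free, audited BY NAME):
`CoherentMorera_of : Sig.stub_coherenceShift → Sig.stub_characterOrDegenerate → Sig.stub_traceCollapse →
  Sig.stub_vertexRelation → Sig.stub_pairingIdentity_of → Sig.stub_vertexToModeZero →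
  Sig.stub_precompactTransfer → CoherentMorera`.

Disproof used (crux workfile `Cruxes/CoherentMorera/Disproof.lean`, cdisprove g3; landed
`Theorems/CoherentMorera/Negative/{KirchhoffModes, CharacterSelectionLoadBearing, VertexTraceStaggering}`):
§A one-sidedness (no `_false_without_` theorem exists; the crux resists refutation); §E
`CharacterSelectionLoadBearing` = "rotation covariance is LOAD-BEARING" (`modelField μ`: Kirchhoff +
coherence with a NON-character + precompactness do not give clause (i); `uModel_not_character`) — this
line IS that input: the covariance is used exactly once, in `stub_coherenceShift`, and the non-character
case is sent to the degenerate branch by `stub_characterOrDegenerate`; §D `character_single_mode` /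
`character_const_of_A0_ne_zero` = the algebra of `stub_traceCollapse` (re-proved below over the
route's offset-indexed `u`); §F `VertexTraceStaggering` (EdgePrecompact (ii) load-bearing for clause
(ii)) — honoured: `stub_precompactTransfer` consumes `EdgePrecompact` incl. (ii), and clause (i) is
never routed through pointwise vertex values (triage T3 erratum: for `λ = ±i` the VERTEX trace is not
pointwise small; only the SITE mode `A₀` is, which is all clause (i) consumes via `stub_vertexToModeZero`);
`Negative/ChiOneFaceStaggering` (triage r1-2): no stub claims "Kirchhoff kills χ₁" — χ₁ is handled by
`Σu = 0`. No stub is an instance refuted by a landed Negative lemma (the §E/§F models violate the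
HYPOTHESES of no stub: §E's field is coherent with a non-character AND non-degenerate, which
`stub_characterOrDegenerate` shows cannot happen for a shift-invariant coherence SET — the model is not
quarter-turn covariant; §F's field violates EdgePrecompact (ii), a hypothesis of `stub_precompactTransfer`).

Imports: the route file (vocabulary of the crux, `Mathlib`, `HarnessLib`), the landed definitions
module `Theorems/CardyComplexConeDefs` of the sibling crux `EdgePrecompact` (its datum-form
`cornerObs E δ v f` is our `cornerObsAt δ E v f` by `rfl`, `cornerObsAt_eq_qkz`; its LANDED
`stub_translationCovariance` + `CardyComplexConeEdgePrecompactMedialExplorationShiftData` are the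
template for the rotation covariance of `stub_coherenceShift`) and `DartPhase` (`dartPhaseSum`,
`bondDartObservable`, `norm_bondDartObservable_le_one`: `‖E_δ‖ ≤ 1` unconditionally).
NOT imported: `MedialInterfaceProofs` / the barrier file / `Negative/KirchhoffModes` (their import
closure contains `FermionicObservable`, whose constants `passageSum`/`winding` would shadow the
`MedialWinding` aliases the route decls are written over — Disproof §A caveat); the needed algebra is
re-proved here over offsets.
-/

noncomputable section

namespace Summit.CriticalPhenomena.CardyFormulaZ2.Cruxes.CoherentMorera.Z4TraceCharacterCollapse

open scoped BigOperators Topology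
open Filter Set MeasureTheory
open Literature.Probability.LatticeModels Literature.Probability.RandomPlanarGeometry
open Literature.Probability.Percolation (BondConfig bondPercolation half)
open Summit.CriticalPhenomena.CardyFormulaZ2.Theses.CardyComplexCone
  (EdgeCoherence EdgePrecompact CoherentMorera)

/-! ### Vocabulary: corners, classes, the corner observable, modes, pairings -/

/-- Unit lattice vector `e₀ = (1,0)`. -/
abbrev e0 : Site 2 := Pi.single 0 1
/-- Unit lattice vector `e₁ = (0,1)`. -/
abbrev e1 : Site 2 := Pi.single 1 1

/-- The spin-`1/3` corner phase functional at mesh `δ`, datum `E`, corner `(v, f)`, configuration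
`ω` — VERBATIM the integrand of `EdgeCoherence`/`EdgePrecompact` with `Λ δ ↦ E`
(it is `dartPhaseSum (medialExploration E ω) δ (1/3) (v, f)`: `cornerPhase_eq_dartPhaseSum`). -/
def cornerPhase (δ : ℝ) (E : DiscreteDobrushin) (v f : Site 2) (ω : BondConfig (Site 2)) : ℂ :=
  (let γ := Literature.Probability.LatticeModels.medialExploration E ω; ∑ k ∈ (Finset.range γ.length).filter (fun k => γ[k]? = some (Literature.Probability.LatticeModels.cornerSource v f) ∧ γ[k + 1]? = some (Literature.Probability.LatticeModels.cornerTarget v f)), Complex.exp (-(Complex.I / 3) * ((Literature.Probability.LatticeModels.winding ((γ.map (Literature.Probability.LatticeModels.medialPoint δ)).take (k + 2)) : ℝ) : ℂ)))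

/-- The corner observable of ONE discrete Dobrushin datum `E` read at mesh `δ` (datum form, for the
exact lattice statements `stub_vertexRelation` and the covariance behind `stub_coherenceShift`). -/
def cornerObsAt (δ : ℝ) (E : DiscreteDobrushin) (v f : Site 2) : ℂ :=
  ∫ ω, cornerPhase δ E v f ω ∂(bondPercolation (zdGraph 2) half)

/-- The corner observable `E_δ(v,f)` along a family `Λ` (VERBATIM the `let E` of `EdgeCoherence`;
same text as `Sketch11388i3.cornerObs`, so the sibling skeleton's stubs coincide with ours). -/
def cornerObs (Λ : ℝ → DiscreteDobrushin) (δ : ℝ) (v f : Site 2) : ℂ :=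
  ∫ ω, (let γ := medialExploration (Λ δ) ω;
    ∑ k ∈ (Finset.range γ.length).filter (fun k => γ[k]? = some (cornerSource v f) ∧
        γ[k + 1]? = some (cornerTarget v f)),
      Complex.exp (-(Complex.I / 3) * ((winding ((γ.map (medialPoint δ)).take (k + 2)) : ℝ) : ℂ)))
    ∂(bondPercolation (zdGraph 2) half)

/-- Family form = datum form at `E = Λ δ` (definitional). -/
theorem cornerObs_eq_cornerObsAt (Λ : ℝ → DiscreteDobrushin) (δ : ℝ) (v f : Site 2) :
    cornerObs Λ δ v f = cornerObsAt δ (Λ δ) v f := rfl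

/-- The crux integrand is the named dart phase sum of `DartPhase.lean`. -/
theorem cornerPhase_eq_dartPhaseSum (δ : ℝ) (E : DiscreteDobrushin) (v f : Site 2)
    (ω : BondConfig (Site 2)) :
    cornerPhase δ E v f ω = dartPhaseSum (medialExploration E ω) δ (1 / 3) (v, f) := by
  unfold cornerPhase Parafermion.dartPhaseSum
  refine Finset.sum_congr rfl fun k _ => ?_
  congr 1
  push_cast
  ring

/-- The corner observable is the named dart observable (so `‖cornerObsAt δ E v f‖ ≤ 1`
unconditionally: `norm_cornerObsAt_le_one`). -/
theorem cornerObsAt_eq_bondDartObservable (δ : ℝ) (E : DiscreteDobrushin) (v f : Site 2) :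
    cornerObsAt δ E v f = bondDartObservable E δ (1 / 3) (v, f) := by
  simp only [cornerObsAt, cornerPhase_eq_dartPhaseSum, Parafermion.bondDartObservable_def]

/-- `‖E_δ(v,f)‖ ≤ 1` for every datum, mesh and corner (the only a-priori bound the line uses). -/
theorem norm_cornerObsAt_le_one (δ : ℝ) (E : DiscreteDobrushin) (v f : Site 2) :
    ‖cornerObsAt δ E v f‖ ≤ 1 := by
  rw [cornerObsAt_eq_bondDartObservable]
  exact norm_bondDartObservable_le_one E δ (1 / 3) (v, f)

/-- Datum form = the sibling crux's landed vocabulary `QkzStripBoundaryArm.cornerObs E δ v f`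
(`Theorems/CardyComplexConeDefs`; its translation covariance `stub_translationCovariance` is LANDED —
the template for the quarter-turn covariance behind `stub_coherenceShift`). -/
theorem cornerObsAt_eq_qkz (δ : ℝ) (E : DiscreteDobrushin) (v f : Site 2) :
    cornerObsAt δ E v f =
      Summit.CriticalPhenomena.CardyFormulaZ2.Cruxes.EdgePrecompact.QkzStripBoundaryArm.cornerObs E δ v f :=
  rfl

/-- `ℤ₄`-Fourier mode `0` of the four corner classes at the SITE `v` (the spin-`1/3` site observable
`A₀(v) = E(v,v) + E(v,v−e₀) + E(v,v−e₀−e₁) + E(v,v−e₁)`; Disproof `A0` under `faceAt_sub`). -/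
def siteModeZero (Λ : ℝ → DiscreteDobrushin) (δ : ℝ) (v : Site 2) : ℂ :=
  cornerObs Λ δ v v + cornerObs Λ δ v (v - e0) + cornerObs Λ δ v (v - e0 - e1) + cornerObs Λ δ v (v - e1)

/-- `ℤ₄`-Fourier mode `2` = the STAGGERED (spin-`7/3`) site observable
`A₂(v) = E(v,v) − E(v,v−e₀) + E(v,v−e₀−e₁) − E(v,v−e₁)` (Disproof `A2`). -/
def siteModeTwo (Λ : ℝ → DiscreteDobrushin) (δ : ℝ) (v : Site 2) : ℂ :=
  cornerObs Λ δ v v - cornerObs Λ δ v (v - e0) + cornerObs Λ δ v (v - e0 - e1) - cornerObs Λ δ v (v - e1)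

/-- `∂̄φ(p) = (φ_x + i φ_y)/2` (as in the route's weak-holomorphy clause). -/
def dbar (φ : ℂ → ℂ) (p : ℂ) : ℂ := (fderiv ℝ φ p 1 + Complex.I * fderiv ℝ φ p Complex.I) / 2
/-- `∂φ(p) = (φ_x − i φ_y)/2`. -/
def del (φ : ℂ → ℂ) (p : ℂ) : ℂ := (fderiv ℝ φ p 1 - Complex.I * fderiv ℝ φ p Complex.I) / 2

/-- The family guards of the crux (domain, mesh, eventual admissibility). -/
def Guards (D : DobrushinDomain) (Λ : ℝ → DiscreteDobrushin) : Prop :=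
  (∀ δ, (Λ δ).Ω = D.carrier) ∧ (∀ δ, (Λ δ).δ = δ) ∧ (∀ᶠ δ in 𝓝[>] (0:ℝ), (Λ δ).IsZdAdmissible)

/-- Admissible test functions for `D` (smooth, compact support inside `D`). -/
def TestFn (D : DobrushinDomain) (φ : ℂ → ℂ) : Prop :=
  ContDiff ℝ (⊤ : ℕ∞) φ ∧ HasCompactSupport φ ∧ tsupport φ ⊆ D.carrier

/-- Mode-`0` pairing null: `δ^{5/3} Σ_v A₀(v) ∂̄φ(δv) → 0`. -/
def ModeZeroPairingNull (Λ : ℝ → DiscreteDobrushin) (φ : ℂ → ℂ) : Prop :=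
  Tendsto (fun δ : ℝ => ((δ ^ ((5:ℝ) / 3) : ℝ) : ℂ) *
    ∑ᶠ v : Site 2, siteModeZero Λ δ v * dbar φ (meshPoint δ v)) (𝓝[>] (0:ℝ)) (𝓝 0)

/-- Mode-`2` pairing null: `δ^{5/3} Σ_v A₂(v) ∂φ(δv) → 0`. -/
def ModeTwoPairingNull (Λ : ℝ → DiscreteDobrushin) (φ : ℂ → ℂ) : Prop :=
  Tendsto (fun δ : ℝ => ((δ ^ ((5:ℝ) / 3) : ℝ) : ℂ) *
    ∑ᶠ v : Site 2, siteModeTwo Λ δ v * del φ (meshPoint δ v)) (𝓝[>] (0:ℝ)) (𝓝 0)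

/-- The crux's weak-holomorphy pairing of the VERTEX observable for one family and one test function
(VERBATIM the body of clause (i) of the conclusion). -/
def VertexPairingNull (Λ : ℝ → DiscreteDobrushin) (φ : ℂ → ℂ) : Prop :=
  Tendsto (fun δ : ℝ => ((δ ^ ((5:ℝ) / 3) : ℝ) : ℂ) * ∑ᶠ z : Literature.Probability.LatticeModels.MedialVertex, (∫ ω, Literature.Probability.LatticeModels.passageSum (Literature.Probability.LatticeModels.medialExploration (Λ δ) ω) δ (1 / 3) z ∂(Literature.Probability.Percolation.bondPercolation (Literature.Probability.LatticeModels.zdGraph 2) Literature.Probability.Percolation.half)) * ((fderiv ℝ φ (Literature.Probability.LatticeModels.medialPoint δ z) 1 + Complex.I * fderiv ℝ φ (Literature.Probability.LatticeModels.medialPoint δ z) Complex.I) / 2)) (𝓝[>] (0:ℝ)) (𝓝 0)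

/-- Clause (i) of the conclusion (family-form weak holomorphy), VERBATIM from the route file. -/
def WeakHolomorphyFamilies : Prop :=
  ∀ (D : Literature.Probability.RandomPlanarGeometry.DobrushinDomain) (Λ : ℝ → Literature.Probability.LatticeModels.DiscreteDobrushin), (∀ δ, (Λ δ).Ω = D.carrier) → (∀ δ, (Λ δ).δ = δ) → (∀ᶠ δ in 𝓝[>] (0:ℝ), (Λ δ).IsZdAdmissible) → ∀ (φ : ℂ → ℂ), ContDiff ℝ (⊤ : ℕ∞) φ → HasCompactSupport φ → tsupport φ ⊆ D.carrier → Tendsto (fun δ : ℝ => ((δ ^ ((5:ℝ) / 3) : ℝ) : ℂ) * ∑ᶠ z : Literature.Probability.LatticeModels.MedialVertex, (∫ ω, Literature.Probability.LatticeModels.passageSum (Literature.Probability.LatticeModels.medialExploration (Λ δ) ω) δ (1 / 3) z ∂(Literature.Probability.Percolation.bondPercolation (Literature.Probability.LatticeModels.zdGraph 2) Literature.Probability.Percolation.half)) * ((fderiv ℝ φ (Literature.Probability.LatticeModels.medialPoint δ z) 1 + Complex.I * fderiv ℝ φ (Literature.Probability.LatticeModels.medialPoint δ z) Complex.I) / 2))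 (𝓝[>] (0:ℝ)) (𝓝 0)

/-- Clause (ii) of the conclusion (vertex precompactness on lattice edges), VERBATIM from the route file. -/
def VertexPrecompactFamilies : Prop :=
  ∀ (D : Literature.Probability.RandomPlanarGeometry.DobrushinDomain) (Λ : ℝ → Literature.Probability.LatticeModels.DiscreteDobrushin), (∀ δ, (Λ δ).Ω = D.carrier) → (∀ δ, (Λ δ).δ = δ) → (∀ᶠ δ in 𝓝[>] (0:ℝ), (Λ δ).IsZdAdmissible) → let F : ℝ → Literature.Probability.LatticeModels.MedialVertex → ℂ := fun δ z => ∫ ω, Literature.Probability.LatticeModels.passageSum (Literature.Probability.LatticeModels.medialExploration (Λ δ) ω) δ (1 / 3) z ∂(Literature.Probability.Percolation.bondPercolation (Literature.Probability.LatticeModels.zdGraph 2) Literature.Probability.Percolation.half); ∀ K : Set ℂ, IsCompact K → K ⊆ D.carrier → (∃ C : ℝ, ∀ᶠ δ in 𝓝[>] (0:ℝ), ∀ z : Literature.Probability.LatticeModels.MedialVertex, z ∈ (Literature.Probability.LatticeModels.zdGraph 2).edgeSet → Literature.Probability.LatticeModels.medialPoint δ z ∈ K → ‖F δ z‖ ≤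 C * δ ^ ((1:ℝ) / 3)) ∧ (∀ ε > (0:ℝ), ∃ η > (0:ℝ), ∀ᶠ δ in 𝓝[>] (0:ℝ), ∀ z z' : Literature.Probability.LatticeModels.MedialVertex, z ∈ (Literature.Probability.LatticeModels.zdGraph 2).edgeSet → z' ∈ (Literature.Probability.LatticeModels.zdGraph 2).edgeSet → Literature.Probability.LatticeModels.medialPoint δ z ∈ K → Literature.Probability.LatticeModels.medialPoint δ z' ∈ K → dist (Literature.Probability.LatticeModels.medialPoint δ z) (Literature.Probability.LatticeModels.medialPoint δ z') < η → ‖F δ z - F δ z'‖ ≤ ε * δ ^ ((1:ℝ) / 3))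

/-- Certificate: the crux IS `EdgeCoherence → EdgePrecompact → (clause (i) ∧ clause (ii))`. -/
theorem coherentMorera_iff :
    CoherentMorera ↔ (EdgeCoherence → EdgePrecompact → (WeakHolomorphyFamilies ∧ VertexPrecompactFamilies)) :=
  Iff.rfl

/-- The matrix of `EdgeCoherence` with the class vector `u` free — VERBATIM the body of
`EdgeCoherence` after `∃ u, (…) ∧` (so `edgeCoherence_iff` is `Iff.rfl`). -/
def CoherenceWith (u : Site 2 → ℂ) : Prop :=
  ∀ (D : Literature.Probability.RandomPlanarGeometry.DobrushinDomain) (Λ : ℝ → Literature.Probability.LatticeModels.DiscreteDobrushin), (∀ δ, (Λ δ).Ω = D.carrier) → (∀ δ, (Λ δ).δ = δ) → (∀ᶠ δ in nhdsWithin (0:ℝ) (Set.Ioi 0), (Λ δ).IsZdAdmissible) → let E : ℝ → Literature.Probability.LatticeModels.Site 2 → Literature.Probability.LatticeModels.Site 2 → ℂ := fun δ v f => ∫ ω, (let γ := Literature.Probability.LatticeModels.medialExploration (Λ δ) ω; ∑ k ∈ (Finset.range γ.length).filter (fun k => γ[k]? = some (Literature.Probability.LatticeModels.cornerSource v f) ∧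 γ[k + 1]? = some (Literature.Probability.LatticeModels.cornerTarget v f)), Complex.exp (-(Complex.I / 3) * ((Literature.Probability.LatticeModels.winding ((γ.map (Literature.Probability.LatticeModels.medialPoint δ)).take (k + 2)) : ℝ) : ℂ))) ∂(Literature.Probability.Percolation.bondPercolation (Literature.Probability.LatticeModels.zdGraph 2) Literature.Probability.Percolation.half); ∀ K : Set ℂ, IsCompact K → K ⊆ D.carrier → ∀ ε > (0:ℝ), ∀ᶠ δ in nhdsWithin (0:ℝ) (Set.Ioi 0), ∀ v f f' : Literature.Probability.LatticeModels.Site 2, Literature.Probability.LatticeModels.IsCorner v f → Literature.Probability.LatticeModels.IsCorner v f' → Literature.Probability.LatticeModels.meshPoint δ v ∈ K → ‖u (f' - v) * E δ v f - u (f - v) * E δ v f'‖ ≤ ε * δ ^ ((1:ℝ) / 3)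

/-- Weak non-degeneracy of a class vector, VERBATIM from `EdgeCoherence`: `u ≠ 0` on at least one of
the four corner classes `{0, −e₀, −e₀−e₁, −e₁}` (= `{o | IsCorner 0 o}`). -/
def Nondegenerate (u : Site 2 → ℂ) : Prop :=
  ∃ o : Literature.Probability.LatticeModels.Site 2, Literature.Probability.LatticeModels.IsCorner 0 o ∧ u o ≠ 0

/-- Certificate of the copy: `EdgeCoherence` is `∃ u, Nondegenerate u ∧ CoherenceWith u`. -/
theorem edgeCoherence_iff : EdgeCoherence ↔ ∃ u : Site 2 → ℂ, Nondegenerate u ∧ CoherenceWith u :=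
  Iff.rfl

/-- The `ℤ₄` shift of corner classes induced by the quarter turn `R(a,b) = (−b,a)` of `ℤ²` with faces
re-indexed by their new lower-left corner, `(v,f) ↦ (Rv, Rf − e₀)`: on offsets `o = f − v` it is
`o ↦ R o − e₀`, the 4-cycle `0 ↦ −e₀ ↦ −e₀−e₁ ↦ −e₁ ↦ 0` (travel classes NW ↦ SW ↦ SE ↦ NE ↦ NW;
`classShift_zero` … `classShift_neg_e1`; same text as `Sketch11388i3.classShift`). -/
def classShift (o : Site 2) : Site 2 := ![-(o 1), o 0] - e0

/-- `u` is a QUARTER-TURN CHARACTER: `u ∘ classShift = λ · u` on the four corner classes (then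
`λ⁴ = 1` as soon as `u ≠ 0` somewhere; Disproof `IsZ4Character` in offset indexing). -/
def IsQuarterTurnCharacter (u : Site 2 → ℂ) : Prop :=
  ∃ l : ℂ, ∀ o : Site 2, IsCorner 0 o → u (classShift o) = l * u o

/-- The DEGENERATE branch: along every family of every Dobrushin domain the corner observable is
`o(δ^{1/3})` uniformly on compacts (all four classes). -/
def CornerObservableDegenerate : Prop :=
  ∀ (D : DobrushinDomain) (Λ : ℝ → DiscreteDobrushin), Guards D Λ →
    ∀ K : Set ℂ, IsCompact K → K ⊆ D.carrier → ∀ ε > (0:ℝ), ∀ᶠ δ in 𝓝[>] (0:ℝ),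
      ∀ v f : Site 2, IsCorner v f → meshPoint δ v ∈ K → ‖cornerObs Λ δ v f‖ ≤ ε * δ ^ ((1:ℝ) / 3)

/-- The four corners `(v, f)` at the genuine medial vertex `s(x, x + eᵢ)`, clockwise `NW, NE, SE, SW`
(VERBATIM `Literature.Barriers.CriticalPhenomena.medialCornersAt` / the sibling lines' `cornersAt`;
not imported to keep `FermionicObservable` out of the import closure). -/
def cornersAt (x : Site 2) : Fin 2 → Fin 4 → Site 2 × Site 2
  | 0 => ![(x, x), (x + Pi.single 0 1, x), (x + Pi.single 0 1, x - Pi.single 1 1),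
      (x, x - Pi.single 1 1)]
  | 1 => ![(x + Pi.single 1 1, x - Pi.single 0 1), (x + Pi.single 1 1, x), (x, x),
      (x, x - Pi.single 0 1)]

/-- The half-CR VERTEX RESIDUAL with the tree's certified chirality `χ = +i` (clockwise
`NW, NE, SE, SW`): `Φ(NW) − Φ(SE) − i (Φ(NE) − Φ(SW))` — Duminil-Copin 2012 Prop. 4 / DCS 2012
Prop. 8.6 reads `vertexResidual Φ x i = 0` (Disproof §B `kirchhoffAt_zero_iff` / `_one_iff`; same text
as `kenyon-stream-second-relation`'s `vRes`). -/
def vertexResidual (Φ : Site 2 × Site 2 → ℂ) (x : Site 2) (i : Fin 2) : ℂ :=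
  Φ (cornersAt x i 0) - Φ (cornersAt x i 2) - Complex.I * (Φ (cornersAt x i 1) - Φ (cornersAt x i 3))

/-! ### Proved algebra of the trace collapse (pointers for the prover of `stub_traceCollapse`) -/

/-- `IsCorner 0 o` unfolded: each coordinate of `o` is `0` or `−1`. -/
theorem isCorner_zero_iff (o : Site 2) : IsCorner 0 o ↔ ∀ i, o i = 0 ∨ o i = -1 := by
  unfold Literature.Probability.LatticeModels.IsCorner
  refine forall_congr' fun i => ?_
  constructor
  · rintro (h | h)
    · exact Or.inl h.symm
    · exact Or.inr (by simp only [Pi.zero_apply] at h; omega)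
  · rintro (h | h)
    · exact Or.inl (by simp [h])
    · exact Or.inr (by simp only [Pi.zero_apply]; omega)

/-- The four corner classes. -/
theorem isCorner_zero_classes :
    IsCorner 0 (0 : Site 2) ∧ IsCorner 0 (-e0) ∧ IsCorner 0 (-e0 - e1) ∧ IsCorner 0 (-e1) := by
  refine ⟨isCorner_self 0, ?_, ?_, ?_⟩ <;> rw [isCorner_zero_iff] <;> intro i <;>
    fin_cases i <;> simp [e0, e1]

/-- A class is one of the four offsets. -/
theorem eq_of_isCorner_zero {o : Site 2} (h : IsCorner 0 o) :
    o = 0 ∨ o = -e0 ∨ o = -e0 - e1 ∨ o = -e1 := by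
  rw [isCorner_zero_iff] at h
  rcases h 0 with h0 | h0 <;> rcases h 1 with h1 | h1
  · left; ext i; fin_cases i <;> simp [h0, h1]
  · right; right; right; ext i; fin_cases i <;> simp [h0, h1, e1]
  · right; left; ext i; fin_cases i <;> simp [h0, h1, e0]
  · right; right; left; ext i; fin_cases i <;> simp [h0, h1, e0, e1]

/-- The shift cycle, step 1: `0 ↦ −e₀`. -/
@[simp] theorem classShift_zero : classShift 0 = -e0 := by
  ext i; fin_cases i <;> simp [classShift, e0]

/-- Step 2: `−e₀ ↦ −e₀−e₁`. -/
@[simp] theorem classShift_neg_e0 : classShift (-e0) = -e0 - e1 := by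
  ext i; fin_cases i <;> simp [classShift, e0, e1]

/-- Step 3: `−e₀−e₁ ↦ −e₁`. -/
@[simp] theorem classShift_neg_e0_sub_e1 : classShift (-e0 - e1) = -e1 := by
  ext i; fin_cases i <;> simp [classShift, e0, e1]

/-- Step 4: `−e₁ ↦ 0`. -/
@[simp] theorem classShift_neg_e1 : classShift (-e1) = 0 := by
  ext i; fin_cases i <;> simp [classShift, e0, e1]

/-- `classShift` permutes the four classes. -/
theorem isCorner_zero_classShift {o : Site 2} (h : IsCorner 0 o) : IsCorner 0 (classShift o) := by
  obtain ⟨h0, h1, h2, h3⟩ := isCorner_zero_classes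
  rcases eq_of_isCorner_zero h with rfl | rfl | rfl | rfl <;> simpa

/-- **Trace kills characters** (the card's `TraceKillsCharacters`, here with the sharper hypothesis
`λ ≠ 1` only): a quarter-turn character with ratio `λ ≠ 1` has class sum zero,
`u(0) + u(−e₀) + u(−e₀−e₁) + u(−e₁) = 0` — so under coherence the spin-`1/3` site mode `A₀` is
`O(ε)δ^{1/3}` (branch (b) of `stub_traceCollapse`). Proof: the shift permutes the classes, hence
`Σ_o u(classShift o) = Σ_o u(o) = λ Σ_o u(o)`. -/
theorem sum_classes_eq_zero_of_character {u : Site 2 → ℂ} {l : ℂ} (hl : l ≠ 1)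
    (h : ∀ o : Site 2, IsCorner 0 o → u (classShift o) = l * u o) :
    u 0 + u (-e0) + u (-e0 - e1) + u (-e1) = 0 := by
  obtain ⟨c0, c1, c2, c3⟩ := isCorner_zero_classes
  have h0 := h _ c0
  have h1 := h _ c1
  have h2 := h _ c2
  have h3 := h _ c3
  simp only [classShift_zero, classShift_neg_e0, classShift_neg_e0_sub_e1, classShift_neg_e1] at h0 h1 h2 h3
  have key : (l - 1) * (u 0 + u (-e0) + u (-e0 - e1) + u (-e1)) = 0 := by
    linear_combination -h0 - h1 - h2 - h3
  rcases mul_eq_zero.1 key with h | h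
  · exact absurd (sub_eq_zero.1 h) hl
  · exact h

/-- **The trivial character is constant on the cycle** (branch (c) of `stub_traceCollapse`: then the
staggered mode `A₂` is `O(ε)δ^{1/3}` under coherence). -/
theorem const_of_character_one {u : Site 2 → ℂ}
    (h : ∀ o : Site 2, IsCorner 0 o → u (classShift o) = u o) :
    u (-e0) = u 0 ∧ u (-e0 - e1) = u 0 ∧ u (-e1) = u 0 := by
  obtain ⟨c0, c1, c2, -⟩ := isCorner_zero_classes
  have h0 := h _ c0
  have h1 := h _ c1
  have h2 := h _ c2
  simp only [classShift_zero, classShift_neg_e0, classShift_neg_e0_sub_e1] at h0 h1 h2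
  exact ⟨h0, h1.trans h0, h2.trans (h1.trans h0)⟩

/-- For a non-degenerate character the ratio is a fourth root of unity (not needed by the line;
recorded for the reader: `IsQuarterTurnCharacter` + `Nondegenerate` = Disproof `IsZ4Character`). -/
theorem pow_four_eq_one_of_character {u : Site 2 → ℂ} {l : ℂ} (hu : Nondegenerate u)
    (h : ∀ o : Site 2, IsCorner 0 o → u (classShift o) = l * u o) : l ^ 4 = 1 := by
  obtain ⟨c0, c1, c2, c3⟩ := isCorner_zero_classes
  have h0 := h _ c0
  have h1 := h _ c1
  have h2 := h _ c2
  have h3 := h _ c3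
  simp only [classShift_zero, classShift_neg_e0, classShift_neg_e0_sub_e1, classShift_neg_e1] at h0 h1 h2 h3
  have cyc : ∀ o : Site 2, IsCorner 0 o → (l ^ 4 - 1) * u o = 0 := by
    intro o ho
    rcases eq_of_isCorner_zero ho with rfl | rfl | rfl | rfl
    · linear_combination -h3 - l * h2 - l ^ 2 * h1 - l ^ 3 * h0
    · linear_combination -h0 - l * h3 - l ^ 2 * h2 - l ^ 3 * h1
    · linear_combination -h1 - l * h0 - l ^ 2 * h3 - l ^ 3 * h2
    · linear_combination -h2 - l * h1 - l ^ 2 * h0 - l ^ 3 * h3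
  obtain ⟨o, ho, huo⟩ := hu
  rcases mul_eq_zero.1 (cyc o ho) with h | h
  · exact sub_eq_zero.1 h
  · exact absurd h huo

/-- The `2 × 2` elimination identity behind `stub_characterOrDegenerate` (triage r1-1 Scratch.lean):
with `w = u ∘ classShift` and `d = u_{o′} w_o − u_o w_{o′}`,
`E_p · d = w_p (u_{o′} E_o − u_o E_{o′}) + u_{o′} (w_o E_p − w_p E_o) − u_o (w_{o′} E_p − w_p E_{o′})`,
each bracket a coherence defect `≤ ε δ^{1/3}`. -/
theorem two_by_two_elimination (Ep Eo Eo' uo uo' wp wo wo' : ℂ) :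
    Ep * (uo' * wo - uo * wo') =
      wp * (uo' * Eo - uo * Eo') + uo' * (wo * Ep - wp * Eo) - uo * (wo' * Ep - wp * Eo') := by
  ring

/-! ### The seven registered stubs

Each stub's statement is the `Prop` `Sig.stub_<name>`; the registered obligation is
`theorem stub_<name> : Sig.stub_<name> := by sorry`; the composition `CoherentMorera_of` takes the
statements as hypotheses BY NAME and is sorry-free. -/

/-- STUB 1 — **COHERENCE SHIFT = exact quarter-turn covariance + universality** (the z4 ENGINE; size L;
provable now; Disproof §E: THE load-bearing input). If `u` is a coherence vector for ALL Dobrushin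
domains and ALL families, so is `u ∘ classShift`. Proof plan: given `(D, Λ, K, ε)` apply
`CoherenceWith u` to the ROTATED data — the Dobrushin domain `iD` (carrier `(I • ·) '' D.carrier`,
boundary `I • D.boundary`, same marks: every `JordanDomain`/`MarkedDomain` field transports along the
linear isometry `z ↦ iz`; definition request D1 `MarkedDomain.mulI`, routine), the family
`δ ↦ ⟨(I•·) '' (Λ δ).Ω, (Λ δ).δ, (I•·) '' (Λ δ).arcA, (I•·) '' (Λ δ).arcB⟩` (guards: `Ω`, mesh by
construction; `IsZdAdmissible` is isometry-EQUIVARIANT — `meshDomain`/`discreteDomainGraph`/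
`meshBoundary`/`zdBoundary`/`zdDiscreteArc` (`Metric.infDist`)/`IsInnerFace`/`zdABEdges` are
coordinate-free) and the compact `I • K`; then pull back along the EXACT COVARIANCE
`cornerObsAt δ (rot E) (R v) (R f − e₀) = cornerObsAt δ E v f`, `R v = ![−(v 1), v 0]`:
`medialExploration (rot E) (ω ∘ R̃⁻¹) = (medialExploration E ω).map R̃` by UNIQUENESS
(`existsUnique_medialExploration_holds`: every clause of `IsMedialExploration` — inner faces, arcs,
`bcBondConfig`, `IsMedialStep`/`IsMedialTurn`, start corner "arc-A site on the left" — is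
equivariant; junk `[] ↦ []`), `IsCorner`/`cornerSource`/`cornerTarget` are equivariant under
`(v,f) ↦ (Rv, Rf − e₀)` (finite coordinate check; planner check `checks/corner_equivariance.py`: ALL OK
on 4 900 (v,f) pairs), `medialPoint δ (R̃ e) = I * medialPoint δ e`, total turning is rotation-invariant
(`SAW.winding_map_affine`, κ = I), and `P_{1/2}` is invariant under the graph automorphism
(`bondPercolation_map_relabel_iso` with `zdSignedPermIso`; `integral_map`). The class of the image
corner is `(Rf − e₀) − Rv = classShift (f − v)`, so the pulled-back inequality is literally
`CoherenceWith (u ∘ classShift)` at `(D, Λ, K, ε)` (`meshPoint δ (Rv) = I * meshPoint δ v ∈ I • K ⟺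
meshPoint δ v ∈ K`). Certified numerically: exact enumeration, 4×3 box vs its quarter turn, 40 corners,
deviation 0.0 (card, cov_a/cov_b.json); cdisprove g2 T4. Why it might fail: only a convention slip in
the corner map (then `classShift⁻¹` appears — immaterial: iterate three times). -/
def Sig.stub_coherenceShift : Prop :=
  ∀ u : Site 2 → ℂ, CoherenceWith u → CoherenceWith (fun o => u (classShift o))

/-- STUB 2 — **CHARACTER OR DEGENERATE** (the z4 DICHOTOMY; size M; provable now; pure algebra +
filter bookkeeping, no percolation input). If `u ≠ 0` on some class and BOTH `u` and `u ∘ classShift`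
are coherence vectors, then either `u ∘ classShift = λ u` on the four classes, or the corner
observable is `o(δ^{1/3})` uniformly on compacts along every family. Proof: if
`u_{o′} w_o = u_o w_{o′}` for all classes (`w = u ∘ classShift`) take `λ = w_{o⋆}/u_{o⋆}` at the class
with `u_{o⋆} ≠ 0`; else fix classes `o, o′` with `d = u_{o′}w_o − u_o w_{o′} ≠ 0` and use
`two_by_two_elimination` at every site `v` with `δv ∈ K`: the three brackets are coherence defects of
`u` (resp. `w`) at the corner pairs `(v+o, v+o′)`, `(v+p, v+o)`, `(v+p, v+o′)`, each `≤ ε δ^{1/3}`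
eventually (intersect the two eventualities), whence `‖E_δ(v, v+p)‖ ≤ (‖w_p‖+‖u_{o′}‖+‖u_o‖) ε δ^{1/3}/‖d‖`
for all four classes `p`; given `ε′` choose `ε = ε′‖d‖/(3 max ‖·‖ + 1)`. (`EdgePrecompact` is NOT
needed — triage r1-2/r1-3 sharpening of finitary's `CharacterOrNull`.) Why it might fail: it cannot
(sixteen numbers); the only trap is the orientation of the defect `u(f′−v)E(v,f) − u(f−v)E(v,f′)`. -/
def Sig.stub_characterOrDegenerate : Prop :=
  ∀ u : Site 2 → ℂ, Nondegenerate u → CoherenceWith u → CoherenceWith (fun o => u (classShift o)) →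
    IsQuarterTurnCharacter u ∨ CornerObservableDegenerate

/-- STUB 3 — **TRACE COLLAPSE** (the card's title lever; size M; provable now; algebra
`sum_classes_eq_zero_of_character` / `const_of_character_one` + coherence bookkeeping + counting
`#{v ∈ ℤ² : δv ∈ tsupport φ} ≤ C_φ δ⁻²`). Under coherence with a non-degenerate `u` which is a character
or degenerate, for every family and test function ONE of the two mode pairings is null:
(a) degenerate ⇒ `‖A₀(v)‖ ≤ 4ε δ^{1/3}` on `tsupport φ` eventually ⇒ `‖δ^{5/3} Σ_v A₀ ∂̄φ(δv)‖ ≤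
4 C_φ ‖∂̄φ‖_∞ ε` for small `δ`, every `ε` ⇒ mode-0 pairing null; (b) character with `λ ≠ 1` ⇒
`Σ_o u(o) = 0`; coherence at `(v, v+o⋆)` gives `E(v,v+o) = (u_o/u_{o⋆}) E(v,v+o⋆) + r_o`,
`‖r_o‖ ≤ ε δ^{1/3}/‖u_{o⋆}‖`, so `A₀(v) = Σ_o r_o` and `‖A₀(v)‖ ≤ 4ε δ^{1/3}/‖u_{o⋆}‖` uniformly ⇒ mode-0
pairing null (NO a-priori bound on `E` is used); (c) `λ = 1` ⇒ `u ≡ u_{o⋆} ≠ 0` on the cycle ⇒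
`‖E(v,v+o) − E(v,v+o⋆)‖ ≤ ε δ^{1/3}/‖u_{o⋆}‖` ⇒ `‖A₂(v)‖ ≤ 4ε δ^{1/3}/‖u_{o⋆}‖` ⇒ mode-2 pairing null.
(`∂̄φ`, `∂φ` vanish off the compact `tsupport φ ⊆ D`, so the `∑ᶠ` are finite sums over
`{v : δv ∈ tsupport φ}` and `K := tsupport φ` is a legitimate compact of the family statements.)
Triage T3 erratum honoured: these are SITE statements; nothing is claimed about pointwise vertex
traces. Why it might fail: it cannot; size is in the `∑ᶠ`/`Tendsto` plumbing. -/
def Sig.stub_traceCollapse : Prop :=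
  ∀ u : Site 2 → ℂ, Nondegenerate u → CoherenceWith u →
    (IsQuarterTurnCharacter u ∨ CornerObservableDegenerate) →
      ∀ (D : DobrushinDomain) (Λ : ℝ → DiscreteDobrushin), Guards D Λ → ∀ φ : ℂ → ℂ, TestFn D φ →
        ModeZeroPairingNull Λ φ ∨ ModeTwoPairingNull Λ φ

/-- STUB 4 — **THE `χ = +i` VERTEX RELATION for the tree's corner observable on JORDAN carriers**
(Duminil-Copin 2012 Prop. 4 / DCS 2012 Prop. 8.6 at `q = 1`, `σ = 1/3`; size L; provable now; the ONE
model input shared by every line of this crux — it is the sibling route item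
`CardySublatticeCoherence.HalfCRVertexRelation` (stmt-CriticalPhenomena-11306) in its REPAIRED scope C′
"add `E.Ω = D.carrier` for a `DobrushinDomain D`" (refuter g43-12 / grounder g20-17: the unrestricted
`∀ E` form is refuted-misstated by an admissible ANNULUS carrier with both marks on the hole — exact
`ℤ[ζ₁₂]` residual `697·ζ(ζ²−2)/2²¹ ≠ 0` — because the rotation number of the exploration around the hole
is configuration-dependent, monodromy `e^{2πi/3}`; the print's Dobrushin domains are simply connected,
arXiv:1208.3787 p. 6), with the `2δ`-ball locality of `kenyon-stream-second-relation`'s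
`Sig.stub_vertexRelation` (whose carrier-free form inherits the annulus defect at larger inner radius —
note for that line's lead). For a Jordan Dobrushin domain `D`, ℤ²-admissible data `E` on `D.carrier` and
a medial vertex `s(x, x+eᵢ)` whose closed `2δ`-neighbourhood lies in the domain, the four corner values
at it, clockwise `NW, NE, SE, SW`, satisfy `E(NW) − E(SE) = i (E(NE) − E(SW))`. Locality: both endpoints
are then at distance `≥ 3δ/2 > √2·δ` from `Ωᶜ`, hence off `zdBoundary = zdArcA ∪ zdArcB` (so the edge
is FREE under `bcBondConfig`), and the two adjacent closed faces lie in `Ω` (inner faces); the carrier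
being Jordan, the face domain has no hole (triage r1-1 §geometric point, r1-3: a bounded complementary
component of the union of closed inner faces would meet the connected unbounded exterior of the Jordan
curve), so the measure-preserving involution `ω ↦ ω ∆ {s(x,x+eᵢ)}` pairs the passages through the
vertex with windings differing by `±π/2` per turn and `±π` at a double visit (signed Umlaufsatz,
`MedialCycleHopf.medialCycle_turning_holds`); at `σ = 1/3` the per-pair brackets are
`2ζ⁻¹Φ₁₂(ζ) = 0`, `ζ = e^{−iπ/6}` (Disproof g2 §(k) weight table; roadmap: the tree's FK-Ising pairing
programme). CERTIFIED EXACTLY for the tree's conventions on simply connected carriers by five independent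
enumerations (refuters on 11306: 25 boxes / 148 vertex equations, residual ≤ 3.6e-13; ideator 1: 3 boxes
+ 193k toggled pairs; ideator 2: `ℤ[ζ₂₄]`, 24/24, kit j004835; ideator 3: j005085; cdisprove g1/g2:
4 rectangles + 131 084 pairs, j005379/j006260/j006914); `χ = −i` is off by `O(1)`. Why it might fail:
a rough Jordan boundary producing, at some mesh, a mesh component whose face domain is not simply
connected (triagers: impossible for Jordan carriers; one owed enumeration on a notched box, r1-1). -/
def Sig.stub_vertexRelation : Prop :=
  ∀ (D : DobrushinDomain) (E : DiscreteDobrushin), E.Ω = D.carrier → E.IsZdAdmissible →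
    ∀ (x : Site 2) (i : Fin 2),
      Metric.closedBall (medialPoint E.δ s(x, x + Pi.single i 1)) (2 * E.δ) ⊆ E.Ω →
        vertexResidual (fun c : Site 2 × Site 2 => cornerObsAt E.δ E c.1 c.2) x i = 0

/-- STUB 5 — **PAIRING IDENTITY from the vertex relation** (lever L1 of the panel = cards
`staggered-green-transfer` / `spin-shift-defect` (`SpinShiftPairing`) / `finitary-green-pairing`
(`HalfCRPairingBound`); size M–L; provable now GIVEN stub 4). Summation by parts of the `χ = +i`
relation against the test function: for ANY corner function `G` with `‖G‖ ≤ M` obeying the relation at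
the medial vertices within `O(δ)` of `tsupport φ`,
`‖Σ_v [A₀^G(v) ∂̄φ(δv) − i A₂^G(v) ∂φ(δv)]‖ ≤ C(φ) M/δ` (exact Abel rearrangement — the barrier file's
Green identity `sum_halfCRForm_eq_halfCRFlux` pattern — then third-order Taylor at the corner midpoint,
second order cancelling by `p₀/p̄₀ = −i`, and the midpoint→site shift); with `G = E_δ`, `M = 1`
(`norm_cornerObsAt_le_one`) and the relation supplied by stub 4 at `E = Λ δ` (`(Λ δ).Ω = D.carrier`,
`(Λ δ).δ = δ`, eventually admissible; inadmissible meshes give `E ≡ 0`) on `cthickening ρ (tsupport φ)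
⊆ D` for `δ < ρ/3`, the normalised difference is
`O(δ^{5/3}·δ⁻¹) = O(δ^{2/3}) → 0`, so the mode-0 `∂̄`-pairing and `i×` the mode-2 `∂`-pairing tend
to zero TOGETHER (split the finite `∑ᶠ`). Sign/chirality (`∂̄ ↔ A₀`, `−i∂ ↔ A₂`) verified
independently by all three triagers on Kirchhoff-exact potential fields (`|P₀ − iP₂| ∝ δ²→0` vs
`|P₀ + iP₂| ≈ 2|P₀| ∝ δ⁻¹`; kit j011066, j011144). EdgePrecompact is NOT used. Why it might fail: only
with the wrong chirality in stub 4 (then `A₀` pairs with `∂`: the trivial character would be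
anti-holomorphic and the crux false in the non-degenerate world — excluded by the enumerations). -/
def Sig.stub_pairingIdentity_of : Prop :=
  Sig.stub_vertexRelation →
    ∀ (D : DobrushinDomain) (Λ : ℝ → DiscreteDobrushin), Guards D Λ → ∀ φ : ℂ → ℂ, TestFn D φ →
      (ModeZeroPairingNull Λ φ ↔ ModeTwoPairingNull Λ φ)

/-- STUB 6 — **VERTEX ⟺ MODE-0 RESUMMATION** (size M–L; provable now; shared verbatim with
`Sketch11388i3.VertexToModeZero`). The crux's vertex pairing and the mode-0 site pairing tend to zero
together: by the pathwise TRACE IDENTITY `2cos(π/12)·passageSum γ δ (1/3) z = Σ_{k<4} dartPhaseSum γ δ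
(1/3) (cornersAt x i k)` at every genuine medial vertex `z = s(x,x+eᵢ) ∉ zdABEdges` (PROVED by
cdisprove g2, 1227 lines, evidence `20260815T231228Z-Disproof.lean` §(j) — re-land as a `--supports`
helper; = sibling crux 11293's `stub_fourCornerSplit`) and integrability (bounded cylinder functional),
`Σ_z F_δ(z)∂̄φ(m_z) = (2cos(π/12))⁻¹ Σ_c E_δ(c)[∂̄φ(m_{src c}) + ∂̄φ(m_{tgt c})]` (each corner is
incident to exactly its source and target vertex; junk `Sym2` pairs and unvisited edges carry
`passageSum = 0`; the two `A–B` edges have medial points within `(√2 + ½)δ` of `Ωᶜ` — `zdABEdges`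
endpoints lie in `zdArcA ⊆ zdBoundary` — hence outside `tsupport φ ⋐ D` for small `δ`, where
`∂̄φ = 0`: no marks convergence needed, triage T4) `= (cos(π/12))⁻¹ Σ_v A₀(v)∂̄φ(δv) + R_δ`,
`‖R_δ‖ ≤ C_φ δ · #{corners over tsupport φ} · sup‖E‖ = O(δ⁻¹)` by `‖E‖ ≤ 1` and `‖m − δv‖ ≤ δ/√2`;
after `δ^{5/3}`: `o(1)`, and `cos(π/12) ≠ 0`. Why it might fail: only by a convention slip in the
trace identity (position of `2cos(π/12)`), already kernel-checked once. -/
def Sig.stub_vertexToModeZero : Prop :=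
  ∀ (D : DobrushinDomain) (Λ : ℝ → DiscreteDobrushin), Guards D Λ → ∀ φ : ℂ → ℂ, TestFn D φ →
    (VertexPairingNull Λ φ ↔ ModeZeroPairingNull Λ φ)

/-- STUB 7 — **PRECOMPACTNESS TRANSFER, corners → vertices** (clause (ii); size M; provable now; shared
verbatim with `Sketch11388i3.PrecompactTransfer`; Disproof §F honoured: uses EdgePrecompact (ii)).
`EdgePrecompact → VertexPrecompactFamilies`: by the integrated trace identity (stub 6's helper) at
lattice edges `z ∈ (zdGraph 2).edgeSet` with `medialPoint δ z ∈ K` (eventually none is an `A–B` edge,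
as in stub 6), `2cos(π/12) F_δ(z) = Σ_{k<4} E_δ(cornersAt x i k)`; the four corners at a horizontal and
at a vertical vertex carry the same four CLASSES (sibling line `four-class-vertex-transfer`:
`class_partner`), their sites lie within `δ/2` of `medialPoint δ z` (`dist_fst_cornersAt_medialPoint`),
so on the collar `cthickening ρ K ⊆ D` clause (i) is the triangle inequality with constant
`4C/(2cos(π/12))` and clause (ii) compares only SAME-CLASS corners: `ε' = ε·2cos(π/12)/4`, `η = η'/2`,
meshes `δ < min ρ (η'/2)` — the sibling's `parafermionPrecompactRepairedAt_of` is this proof verbatim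
for 6-field families (≈ 110 lines, kernel-checked), minus its `hmarks` step, replaced by the marks-free
collar argument of stub 6. STRONGER than the crux's second half (no `EdgeCoherence`), not a
restatement. Why it might fail: it cannot given the trace identity; `EdgePrecompact` is consumed BY
NAME (crux 11387, staffed). -/
def Sig.stub_precompactTransfer : Prop :=
  EdgePrecompact → VertexPrecompactFamilies

/-- Registered stub 1 (coherence shift — quarter-turn covariance + universality; the z4 engine). -/
theorem stub_coherenceShift : Sig.stub_coherenceShift := by
  sorry

/-- Registered stub 2 (character or degenerate — the 2×2 elimination). -/
theorem stub_characterOrDegenerate : Sig.stub_characterOrDegenerate := by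
  sorry

/-- Registered stub 3 (trace collapse — one mode pairing is null). -/
theorem stub_traceCollapse : Sig.stub_traceCollapse := by
  sorry

/-- Registered stub 4 (the `χ = +i` vertex relation, DC12 Prop. 4 for the tree's observable). -/
theorem stub_vertexRelation : Sig.stub_vertexRelation := by
  sorry

/-- Registered stub 5 (pairing identity from the vertex relation — lever L1). -/
theorem stub_pairingIdentity_of : Sig.stub_pairingIdentity_of := by
  sorry

/-- Registered stub 6 (vertex pairing ⟺ mode-0 pairing — trace identity resummation). -/
theorem stub_vertexToModeZero : Sig.stub_vertexToModeZero := by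
  sorry

/-- Registered stub 7 (precompactness transfer corners → vertices — clause (ii)). -/
theorem stub_precompactTransfer : Sig.stub_precompactTransfer := by
  sorry

/-! ### The composition: the seven stub statements give the crux BY NAME (pure logic) -/

/-- **The line.** Coherence shift + character-or-degenerate + trace collapse + (vertex relation ⇒
pairing identity) + vertex/mode-0 resummation + precompactness transfer imply `CoherentMorera`.
Clause (i): `EdgeCoherence` gives `u` with `Nondegenerate u ∧ CoherenceWith u` (`edgeCoherence_iff`);
stub 1 makes `u ∘ classShift` coherent; stub 2 gives character-or-degenerate; stub 3 makes one mode
pairing null for the given `(D, Λ, φ)`; stub 5 (fed by stub 4) converts a null mode-2 pairing into a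
null mode-0 pairing; stub 6 converts that into the crux's vertex pairing. Clause (ii): stub 7.
`EdgePrecompact` is used only in clause (ii) (Disproof §F); the rotation covariance only in stub 1
(Disproof §E). -/
theorem CoherentMorera_of :
    Sig.stub_coherenceShift → Sig.stub_characterOrDegenerate → Sig.stub_traceCollapse →
      Sig.stub_vertexRelation → Sig.stub_pairingIdentity_of → Sig.stub_vertexToModeZero →
        Sig.stub_precompactTransfer → CoherentMorera := by
  intro hShift hDich hTrace hRel hPair hVert hPre hC hEP
  refine ⟨?_, hPre hEP⟩
  intro D Λ hΩ hδ hadm φ hφ hsupp hsub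
  have hG : Guards D Λ := ⟨hΩ, hδ, hadm⟩
  have hF : TestFn D φ := ⟨hφ, hsupp, hsub⟩
  obtain ⟨u, hnd, hcoh⟩ := edgeCoherence_iff.1 hC
  have hcoh' : CoherenceWith (fun o => u (classShift o)) := hShift u hcoh
  have hdich : IsQuarterTurnCharacter u ∨ CornerObservableDegenerate := hDich u hnd hcoh hcoh'
  rcases hTrace u hnd hcoh hdich D Λ hG φ hF with h0 | h2
  · exact (hVert D Λ hG φ hF).2 h0
  · exact (hVert D Λ hG φ hF).2 ((hPair hRel D Λ hG φ hF).2 h2)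

/-- The skeleton in its final shape: the crux BY NAME from the seven registered stubs (depends on
`sorryAx` only through them). -/
theorem coherentMorera_proof : CoherentMorera :=
  CoherentMorera_of stub_coherenceShift stub_characterOrDegenerate stub_traceCollapse
    stub_vertexRelation stub_pairingIdentity_of stub_vertexToModeZero stub_precompactTransfer

/-! ### Unregistered pointers for the provers (not obligations) -/

/-- The EXACT COVARIANCE behind stub 1, datum form (the card's `QuarterTurnCovariance`; certified on
40 corners, deviation 0.0): rotating the domain, the arcs and the configuration by the quarter turn
maps the corner `(v, f)` to `(Rv, Rf − e₀)` and leaves the spin-`1/3` corner observable unchanged.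
A suggested `--supports` helper, stated over the inline rotated datum. -/
def Aux.QuarterTurnCovariance : Prop :=
  ∀ (E : DiscreteDobrushin) (δ : ℝ) (v f : Site 2), IsCorner v f →
    cornerObsAt δ ⟨(fun z : ℂ => Complex.I * z) '' E.Ω, E.δ, (fun z : ℂ => Complex.I * z) '' E.arcA,
        (fun z : ℂ => Complex.I * z) '' E.arcB⟩ ![-(v 1), v 0] (![-(f 1), f 0] - e0) =
      cornerObsAt δ E v f

/-- The ROTATED DOBRUSHIN DOMAIN behind stub 1 (definition request D1 `MarkedDomain.mulI` as an
existence statement: every field of `JordanDomain`/`MarkedDomain` transports along `z ↦ iz`). -/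
def Aux.RotatedDomainExists : Prop :=
  ∀ D : DobrushinDomain, ∃ D' : DobrushinDomain, D'.carrier = (fun z : ℂ => Complex.I * z) '' D.carrier

/-- The deterministic SUMMATION-BY-PARTS bound behind stub 5 (finitary-green-pairing's
`HalfCRPairingBound`, site form; `C` depends on `φ` only): for any corner function `G` bounded by `M`
and obeying the `χ = +i` relation at the medial vertices whose `2δ`-ball lies in the open set `U ⊇
tsupport φ`, `‖Σ_v [A₀^G ∂̄φ − i A₂^G ∂φ](δv)‖ ≤ C · M / δ` for `δ ≤ δ₀`. A suggested `--supports` helper. -/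
def Aux.HalfCRPairingBound : Prop :=
  ∀ (U : Set ℂ), IsOpen U → ∀ (φ : ℂ → ℂ), ContDiff ℝ 3 φ → HasCompactSupport φ → tsupport φ ⊆ U →
    ∃ C : ℝ, ∃ δ₀ > (0:ℝ), ∀ δ : ℝ, 0 < δ → δ ≤ δ₀ →
      ∀ (G : Site 2 × Site 2 → ℂ) (M : ℝ), 0 ≤ M → (∀ c : Site 2 × Site 2, IsCorner c.1 c.2 → ‖G c‖ ≤ M) →
        (∀ (x : Site 2) (i : Fin 2),
            Metric.closedBall (medialPoint δ s(x, x + Pi.single i 1)) (2 * δ) ⊆ U →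
              vertexResidual G x i = 0) →
        ‖∑ᶠ v : Site 2, ((G (v, v) + G (v, v - e0) + G (v, v - e0 - e1) + G (v, v - e1)) * dbar φ (meshPoint δ v)
            - Complex.I * (G (v, v) - G (v, v - e0) + G (v, v - e0 - e1) - G (v, v - e1)) * del φ (meshPoint δ v))‖
          ≤ C * M / δ

/-- The pathwise TRACE IDENTITY behind stubs 6–7 (= sibling crux 11293's `Sig.stub_fourCornerSplit`,
verbatim; PROVED by cdisprove g2 §(j) in an evidence file — re-land under this namespace with
`--supports stmt-CriticalPhenomena-11388`). -/
def Aux.FourCornerSplit : Prop :=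
  ∀ (E : DiscreteDobrushin) (δ : ℝ), 0 < δ → ∀ (ω : BondConfig (Site 2)) (x : Site 2) (i : Fin 2),
    s(x, x + Pi.single i 1) ∉ E.zdABEdges →
      ((2 * Real.cos (Real.pi / 12) : ℝ) : ℂ) *
          passageSum (medialExploration E ω) δ (1 / 3) s(x, x + Pi.single i 1) =
        ∑ k : Fin 4, dartPhaseSum (medialExploration E ω) δ (1 / 3) (cornersAt x i k)

end Summit.CriticalPhenomena.CardyFormulaZ2.Cruxes.CoherentMorera.Z4TraceCharacterCollapse

end
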